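import Literature.Analysis.FluidPDE.AncientMildDrift
import Literature.Analysis.FluidPDE.MildSolutionHeatFlowProofs
import Literature.Analysis.FluidPDE.AncientMildPairing
import HarnessLib

/-!
# `L¹`-continuity at `σ = 0⁺` of the gradient of the caloric test field

Analysis/FluidPDE support file (all results proved; no definitions, no named facts).

Let `E` be a finite-dimensional real inner product space with its Lebesgue measure, `φ : E → E` a
test field (`C_c^∞`) and `ν > 0`. The caloric test field `heatTest ν φ σ = e^{νσΔ}φ` of the duality
(very weak) formulation of the Navier–Stokes equations has directional derivatives
`D(e^{νσΔ}φ) e = e^{νσΔ}(Dφ e)` (`fderiv_heatTest_apply`: the derivative falls on the data, and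
`Dφ e` is again a test field), and the heat semigroup is strongly continuous on `L¹` at `0⁺`
(`tendsto_heatFlow_nhdsWithin_zero_holds`: Stein, *Singular Integrals*, Ch. III §2, Thm. 2,
specialised to the Gauss–Weierstrass kernel). Hence

* `tendsto_integral_norm_heatTest_sub` — `∫ ‖e^{νσΔ}ψ − ψ‖ → 0` as `σ ↓ 0` for `ψ ∈ L¹`, `ν ≥ 0`
  (real-integral form of the strong continuity);
* `tendsto_integral_norm_fderiv_heatTest_apply_sub` — `∫ ‖D(e^{νσΔ}φ) e − Dφ e‖ → 0` as `σ ↓ 0`;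
* `tendsto_integral_inner_fderiv_heatTest_apply` — for a bounded measurable field `w`, the
  directional pairings `∫ ⟪w, D(e^{νσΔ}φ) e⟫` tend to `∫ ⟪w, Dφ e⟫` as `σ ↓ 0`
  (`|∫⟪w, A_σ − A₀⟫| ≤ ‖w‖_∞ ‖A_σ − A₀‖₁`).

This is the continuity at the terminal time of the kernels
`h^{t,φ}(τ) = (e ↦ ∫⟪w(τ), D(e^{ν(t−τ)Δ}φ) e⟫)` used in the gauge fixing of bounded ancient mild
solutions in duality form (crux `TypeIliouvilleL`, item stmt-NavierStokesRegularity-10661, stub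
`stub_duality_oseen_gauge_ancient`).

## References

* E. M. Stein, *Singular Integrals and Differentiability Properties of Functions* (Princeton 1970),
  Ch. III §2, Thm. 2 (`‖f ⋆ φ_ε − f‖_p → 0`). [SteinSingularIntegrals1970] Folklore.
* E. B. Fabes, B. F. Jones, N. M. Rivière, *The initial value problem for the Navier–Stokes
  equations with data in `L^p`*, Arch. Rational Mech. Anal. 45 (1972), §2, Thm. 2.1 (the caloric
  test fields of the duality identity). [FabesJonesRiviere1972]
-/

noncomputable section

open MeasureTheory Set Function Filter Topology TopologicalSpace InnerProductSpace
open scoped RealInnerProductSpace NNReal ENNReal ContDiff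

namespace Literature.Analysis.FluidPDE

variable {E : Type*} [NormedAddCommGroup E] [InnerProductSpace ℝ E] [FiniteDimensional ℝ E]
  [MeasurableSpace E] [BorelSpace E]
variable {F : Type*} [NormedAddCommGroup F] [NormedSpace ℝ F] [CompleteSpace F]

/-- **Strong continuity of the caloric flow on `L¹` at `σ = 0⁺`, real-integral form**:
`∫ ‖e^{νσΔ}ψ − ψ‖ → 0` as `σ ↓ 0` for `ψ ∈ L¹` and `ν ≥ 0` (`‖e^{tΔ}ψ − ψ‖_{L¹} → 0` as `t → 0`,
`t ≥ 0`, Stein, *Singular Integrals*, Ch. III §2, Thm. 2, along `t = νσ`). [folklore] -/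
theorem tendsto_integral_norm_heatTest_sub {ψ : E → F} (hψ : Integrable ψ) {ν : ℝ} (hν : 0 ≤ ν) :
    Tendsto (fun σ : ℝ => ∫ x, ‖heatTest ν ψ σ x - ψ x‖) (𝓝[>] 0) (𝓝 0) := by
  -- strong continuity of the heat semigroup on `L¹` at `0`, along `σ ↦ ν σ`
  have hsc : Tendsto (fun t : ℝ => eLpNorm (heatFlow ψ t - ψ) 1 volume) (𝓝[≥] 0) (𝓝 0) :=
    tendsto_heatFlow_nhdsWithin_zero_holds (memLp_one_iff_integrable.2 hψ) le_rfl
      ENNReal.one_ne_top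
  have hmul : Tendsto (fun σ : ℝ => ν * σ) (𝓝[>] 0) (𝓝[≥] 0) :=
    tendsto_nhdsWithin_of_tendsto_nhds_of_eventually_within _
      (((continuous_const_mul ν).tendsto' 0 0 (mul_zero ν)).mono_left nhdsWithin_le_nhds)
      (eventually_mem_nhdsWithin.mono fun σ hσ => mul_nonneg hν (le_of_lt hσ))
  have hi : ∀ σ : ℝ, Integrable (heatFlow ψ (ν * σ) - ψ) := fun σ =>
    (integrable_heatFlow hψ _).sub hψ
  have h1 : Tendsto (fun σ : ℝ => (eLpNorm (heatFlow ψ (ν * σ) - ψ) 1 volume).toReal)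
      (𝓝[>] 0) (𝓝 0) :=
    (ENNReal.tendsto_toReal_zero_iff fun σ =>
      (memLp_one_iff_integrable.2 (hi σ)).eLpNorm_ne_top).2 (hsc.comp hmul)
  -- `∫ ‖e^{νσΔ}ψ − ψ‖ = ‖e^{νσΔ}ψ − ψ‖_{L¹}`
  refine h1.congr fun σ => ?_
  rw [eLpNorm_one_eq_lintegral_enorm, ← integral_norm_eq_lintegral_enorm (hi σ).aestronglyMeasurable]
  rfl

/-- **`L¹`-continuity of the gradient of the caloric test field at `σ = 0⁺`**:
`∫ ‖D(e^{νσΔ}φ) e − Dφ e‖ → 0` as `σ ↓ 0` for a test field `φ` (the derivative falls on the data,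
`D(e^{νσΔ}φ) e = e^{νσΔ}(Dφ e)` with `Dφ e ∈ C_c^∞ ⊆ L¹`, and the heat semigroup is strongly
continuous on `L¹`; Stein, *Singular Integrals*, Ch. III §2, Thm. 2). [folklore] -/
theorem tendsto_integral_norm_fderiv_heatTest_apply_sub {φ : E → E}
    (hφ : FunctionSpaces.IsTestFunctionOn (⊤ : Opens E) φ) {ν : ℝ} (hν : 0 < ν) (e : E) :
    Tendsto (fun σ : ℝ => ∫ x, ‖fderiv ℝ (heatTest ν φ σ) x e - fderiv ℝ φ x e‖) (𝓝[>] 0) (𝓝 0) := by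
  refine (tendsto_integral_norm_heatTest_sub
    (memLp_one_iff_integrable.1 ((hφ.fderiv_apply_const e).memLp_volume 1)) hν.le).congr fun σ => ?_
  simp only [fderiv_heatTest_apply hφ]

/-- Hence **the directional pairings of a bounded measurable field with `D(e^{νσΔ}φ) e` tend to the
pairing with `Dφ e` as `σ ↓ 0`**: `∫ ⟪w, D(e^{νσΔ}φ) e⟫ → ∫ ⟪w, Dφ e⟫`, since
`|∫ ⟪w, D(e^{νσΔ}φ) e⟫ − ∫ ⟪w, Dφ e⟫| ≤ M ∫ ‖D(e^{νσΔ}φ) e − Dφ e‖ → 0` for `‖w‖ ≤ M`. [folklore] -/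
theorem tendsto_integral_inner_fderiv_heatTest_apply {w : E → E}
    (hw : AEStronglyMeasurable w volume) {M : ℝ} (hM : ∀ x, ‖w x‖ ≤ M)
    {φ : E → E} (hφ : FunctionSpaces.IsTestFunctionOn (⊤ : Opens E) φ) {ν : ℝ} (hν : 0 < ν) (e : E) :
    Tendsto (fun σ : ℝ => ∫ x, ⟪w x, fderiv ℝ (heatTest ν φ σ) x e⟫) (𝓝[>] 0)
      (𝓝 (∫ x, ⟪w x, fderiv ℝ φ x e⟫)) := by
  have hgi : Integrable (fun z => fderiv ℝ φ z e) :=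
    memLp_one_iff_integrable.1 ((hφ.fderiv_apply_const e).memLp_volume 1)
  have hAi : ∀ σ, Integrable (fun x => fderiv ℝ (heatTest ν φ σ) x e) := fun σ => by
    simp_rw [fderiv_heatTest_apply hφ]
    exact integrable_heatFlow hgi _
  have hPi : ∀ σ, Integrable (fun x => ⟪w x, fderiv ℝ (heatTest ν φ σ) x e⟫) := fun σ =>
    integrable_inner_of_aestronglyMeasurable_of_norm_le hw hM (hAi σ)
  have hP0 : Integrable (fun x => ⟪w x, fderiv ℝ φ x e⟫) :=
    integrable_inner_of_aestronglyMeasurable_of_norm_le hw hM hgi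
  rw [tendsto_iff_norm_sub_tendsto_zero]
  refine squeeze_zero' (Eventually.of_forall fun σ => norm_nonneg _)
    (Eventually.of_forall fun σ => ?_)
    (by simpa using (tendsto_integral_norm_fderiv_heatTest_apply_sub hφ hν e).const_mul M)
  -- `‖∫⟪w, A_σ⟫ − ∫⟪w, A₀⟫‖ = ‖∫⟪w, A_σ − A₀⟫‖ ≤ M ∫ ‖A_σ − A₀‖`
  rw [← integral_sub (hPi σ) hP0, ← integral_const_mul]
  refine norm_integral_le_of_norm_le (((hAi σ).sub hgi).norm.const_mul M)
    (Eventually.of_forall fun x => ?_)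
  rw [← inner_sub_right]
  calc ‖⟪w x, fderiv ℝ (heatTest ν φ σ) x e - fderiv ℝ φ x e⟫‖
      ≤ ‖w x‖ * ‖fderiv ℝ (heatTest ν φ σ) x e - fderiv ℝ φ x e‖ := norm_inner_le_norm _ _
    _ ≤ M * ‖fderiv ℝ (heatTest ν φ σ) x e - fderiv ℝ φ x e‖ :=
      mul_le_mul_of_nonneg_right (hM x) (norm_nonneg _)

end Literature.Analysis.FluidPDE
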